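import Summits.BirchSwinnertonDyer.Rank1Residual.X9.LeafDischargeScalarImage
import Summits.BirchSwinnertonDyer.Rank1Residual.X9.LeafDischargeKolyvaginCebotarev
import Summits.BirchSwinnertonDyer.Rank1Residual.X10.LeafDischargeX10bKolyvagin
import Literature.NumberTheory.EllipticCurves.YanZhu2026.BDPMainConjectureAtTrivialCharacterOfHeegnerDivisibility
import Literature.NumberTheory.EllipticCurves.LambdaAdicSelmerDataProofs
import Literature.NumberTheory.EllipticCurves.IwasawaSelmerDualProofs
import Literature.NumberTheory.EllipticCurves.HeegnerNormPointExistenceProofs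
import Literature.NumberTheory.QuadraticFields.HeegnerCondition
import HarnessLib

/-!
# Classes X9 / X10b: the DISCHARGE INTERFACE for the TWO-SIDED anticyclotomic main conjecture at the
# trivial character WITHOUT surjectivity — Yan–Zhu 2026 (5.7 (1) + 5.9) ∘ BCS 2025 (4.2.2) ∘ CGLS 2022
# (5.1.3), GRANTED Howard's divisibility, which Mastella–Zerman 2026 Cor. 4.6 supplies on both leaves

Print-tier cell `bsd-print-x9` (D-0131 (2), key `x9`), typer seat ty2, file Q of the discharge
interface (A = `X9/LeafDischarge`, …, F = `X9/LeafDischargeKolyvaginCebotarev`, I =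
`X10/LeafDischargeX10bKolyvagin`, P = `X9/LeafDischargeScalarImage`; the Summits-side links built on
this file are file R `X9/LeafDischargeHowardBDPLinks`). THEOREMS ONLY: no definition, no new named
fact (D-0014 / D-0026); every published input is one of the tree's existing named facts, taken as an
explicit binder (`h57`, `h46`); nothing here is a class theorem; X9 and X10b keep their labels.

## What this file is for (the prover seat p4's "J-free Howard road", gen 3)

On the rank-one rows of the partition the tree holds the printed route of BCS 2025 Cor. 1.3.1 with NO
Tamagawa proviso: the TWO-SIDED anticyclotomic link `X11b.IMCWaldspurgerOnTreeGoodAt` from the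
composite fact `BurungaleCastellaSkinner2025.thm124b_thm513_generator_constantCoeff` (BCS Thm. 1.2.4
(b) ∘ CGLS Thm. 5.1.3, printed under (sur)) + JSW 2017 Thm. 3.3.1, then the Heegner-index identity
over `K` and `BSD(E,p)` (`Partition/MainConjecturesIrreducibleIdentityRows.lean`). On the leaves X9
(`p ∈ {5,7}`, irreducible NON-surjective image) and X10b (`p = 3`, images 3Ns/3Nn) (sur) fails by
definition. The cell's ty1 seat typed the (sur)-free sibling of that composite,
`YanZhu2026.thm57_thm59_bcs422_cgls513_generator_constantCoeff_of_heegnerDivisibility` (Yan–Zhu Thm.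
5.7 (1) rational + Thm. 5.9 + BCS Prop. 4.2.2 + CGLS Thm. 5.1.3; conclusion LETTER FOR LETTER the
(sur)-sibling's), whose only image-dependent input — Howard's containment `Char(S_ord/Λκ)² ⊆
Char(𝒳_ord,tor)` — is an explicit ∃-hypothesis over Howard's data `(jbar, D, F, X)`; and
Mastella–Zerman 2026 Cor. 4.6 (`MastellaZerman2026.cor46_howardDivisibility_of_scalarImage`, Howard's
Thm. B at any odd `p` under (irr) + "the `p`-adic image contains `1 + pℤ_p`"), whose hypothesis
structure is CONSTRUCTED on both leaves by file P (`ClassX9.mz26Hypotheses`,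
`ClassX10.mz26Hypotheses_of_not_surj`; the scalar condition is a kernel theorem, Lombardo–Tronto 2022).
This file closes the Literature-currency doors:

1. §1 `exists_howardData_of_heegner` — Howard's data EXIST on every Heegner frame with `p ∤ N`: an
   embedding `jbar : K̄ → ℂ` (`IsAlgClosed.lift`), a `Λ`-adic Selmer datum `D` (tree theorem
   `LambdaAdicSelmerDataExists.nonempty_lambdaAdicSelmerData`, Perrin-Riou 1987 §0), a Heegner family
   `F` at level `N` (tree theorems `exists_isHeegnerNormPoint_holds` + `nonempty_heegnerFamily_of`,
   Howard 2004 §2.7/§3.3, with an orientation `β² ≡ d_K (mod 4N)` from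
   `Quadratic.exists_dvd_sq_sub_discr_of_ncard_primesOver`, Gross 1984 §3) and a Selmer-dual datum
   `X` (tree theorem `nonempty_selmerDualData_holds`, Greenberg LNM 1716 §1). So the composite's
   ∃-hypothesis is not vacuous and is discharged, not carried.
2. §2 `ClassX9.exists_heegnerContainment_of_cor46` — on an X9 Heegner frame at the parametrisation
   level `N = N_E` with `d_K` odd `≠ −3` and `p ∤ h_K`, Howard's containment HOLDS for some data
   (MZ26 Cor. 4.6 by name ∘ file P ∘ §1); `ClassX9.yz26_generator_constantCoeff_of_cor46` — the
   INTEGRAL identity at `𝟙` (`𝒳_{𝓕_Gr}` torsion, `Char = (F)`, `F(0) = u·c_E⁻²(1 − a_p p⁻¹ + p⁻¹)²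
   log²(P_K)`, `u ∈ ℤ_p^×`) on X9 frames, every class-level binder of the composite discharged
   (`3 ≤ p`, good ordinary, (irr_K) IN THE KERNEL by file F `ClassX9.irr_baseChange_of_heegner`);
   `ClassX9.hasCharValuationAt_of_yz26_of_cor46` — the same in the packaged valuation currency.
3. §3 the X10b twins at `p = 3` (`ClassX10 W p`, `¬ Surj W 3`, non-CM explicit since X10b has CM
   members): Yan–Zhu 5.7/5.9, BCS 4.2.2, CGLS 5.1.3 and MZ26 Cor. 4.6 are all typed at `p > 2` / odd
   `p`, so the same doors exist at `3` (flag `YZ26@3-BF-ERL-Ohta` travels with `h57`, as recorded in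
   its docstring).

Binder order as in files A–P: published facts, class hypothesis, then per-frame data. What is LEFT
per frame after files Q/R, relative to the (sur) road: the ONE extra binder `p ∤ h_K` (MZ26
Assumption 2.1 = the Heegner-family vocabulary's standing hypothesis =
`Thm57Hypotheses.not_dvd_classNumber`), and the named facts `h57` (flag
`YZ26-57i+59+BCS422+CGLS513-composite`), `h46` (PUB).

## References

* [YanZhu2024MainConjNonCM] X. Yan, X. Zhu, J. Algebra 693 (2026) = arXiv:2412.20078, Thm. 5.7 (1),
  Thm. 5.9, §5.2.
* [BurungaleCastellaSkinner2025] IMRN 2025 = arXiv:2405.00270v2, Prop. 4.2.2, Thm. 4.2.1 (proof, p. 8),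
  Cor. 1.3.1 (proof, p. 4).
* [CastellaGrossiLeeSkinner2022] Invent. Math. 227 (2022), Thm. 5.1.3.
* [MastellaZerman2026] Ann. Math. Québec (2026) = arXiv:2505.08710, Assumptions 2.1/2.13, Cor. 4.6.
* [LombardoTronto2022] Pacific J. Math. 320 (2022), Thm. 3.16, Prop. 3.12.
* [Howard2004HeegnerKolyvagin] Compositio 140 (2004), §2.7, §3.3, Thm. B.
* [PerrinRiou1987BSMF] §0; [GreenbergLNM1716] §1; [Gross1984] §3; [MatarNekovar2019] Prop. 5.26 (2).
* Tree: `YanZhu2026/BDPMainConjectureAtTrivialCharacterOfHeegnerDivisibility.lean` (p563407),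
  `X9/LeafDischargeScalarImage.lean` (file P, p566503), `KellerYin2024/HeegnerPairDataExistence.lean`
  (the pattern of §1).
-/

set_option autoImplicit false

noncomputable section

open scoped Classical

open WeierstrassCurve NumberField IsDedekindDomain Literature.NumberTheory.EllipticCurves
  Literature.NumberTheory.EllipticCurves.ModularForms
  Literature.NumberTheory.EllipticCurves.YanZhu2026
  Literature.NumberTheory.EllipticCurves.MastellaZerman2026
  Literature.NumberTheory.EllipticCurves.Castella2018

/-! ## §1 Howard's data exist on a Heegner frame (no class hypothesis) -/

namespace Literature.NumberTheory.EllipticCurves.Rank1Residual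

section Data

variable {W : WeierstrassCurve ℚ} [W.IsElliptic] {p : ℕ} [Fact p.Prime]
  {K : Type} [Field K] [NumberField K]

/-- **Howard's data exist.** For `E/ℚ` elliptic with a parametrisation datum at level `N`, `K`
imaginary quadratic with the Heegner hypothesis for `N`, `p ∤ N`, and `(κ, γ)` with `γ` a topological
generator: there are an embedding `jbar : K̄ → ℂ`, a `Λ`-adic Selmer datum `D = 𝔖_p(E/K_∞)`
(Perrin-Riou 1987 §0; tree theorem `LambdaAdicSelmerDataExists.nonempty_lambdaAdicSelmerData`), a
Heegner family `F` at level `N` (Howard 2004 §2.7/§3.3; tree theorems `exists_isHeegnerNormPoint_holds`,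
`nonempty_heegnerFamily_of`, orientation from Gross 1984 §3
`Quadratic.exists_dvd_sq_sub_discr_of_ncard_primesOver`) and a Selmer-dual datum `X` (Greenberg LNM
1716 §1; tree theorem `nonempty_selmerDualData_holds`). Non-vacuity of every "for all data" Howard-type
statement of the tree at such frames. [cite: Howard2004HeegnerKolyvagin, §2.7, §3.3 (the objects 𝔖, 𝐇, X of Thm. B)]
[cite: PerrinRiou1987BSMF, §0 p. 402] [cite: GreenbergLNM1716, §1] [cite: Gross1984, §3] -/
theorem exists_howardData_of_heegner {N : ℕ} [NeZero N] (hK : IsImaginaryQuadratic K)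
    (hHN : SatisfiesHeegnerHypothesis N K) (hpN : ¬ p ∣ N) (κ : ZpExtension K p)
    {γ : Field.absoluteGaloisGroup K} (hγ : κ.IsTopGenerator γ) (Dt : ModularParametrizationData W N) :
    ∃ (jbar : AlgebraicClosure K →+* ℂ) (_ : (W.baseChange K).LambdaAdicSelmerData κ γ)
      (_ : HeegnerFamily N W K κ jbar) (_ : (W.baseChange K).SelmerDualData κ γ), True := by
  haveI : Algebra.IsAlgebraic ℚ (AlgebraicClosure K) := Algebra.IsAlgebraic.trans ℚ K _
  let jbar : AlgebraicClosure K →+* ℂ :=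
    (IsAlgClosed.lift (R := ℚ) (M := ℂ) (S := AlgebraicClosure K)).toRingHom
  obtain ⟨β, hβ⟩ :=
    Literature.NumberTheory.QuadraticFields.Quadratic.exists_dvd_sq_sub_discr_of_ncard_primesOver
      hK.1 (NeZero.ne N) hHN
  obtain ⟨D⟩ := LambdaAdicSelmerDataExists.nonempty_lambdaAdicSelmerData (W.baseChange K) p κ hγ
  obtain ⟨F⟩ := nonempty_heegnerFamily_of (exists_isHeegnerNormPoint_holds N W K p) hK hHN hpN κ Dt
    hβ jbar
  obtain ⟨X⟩ := (W.baseChange K).nonempty_selmerDualData_holds κ γ hγ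
  exact ⟨jbar, D, F, X, trivial⟩

end Data

/-! ## §2 Class X9: Howard's containment and the integral identity at `𝟙`, BY NAME -/

section X9

variable {W : WeierstrassCurve ℚ} [W.IsElliptic] [W.IsGloballyMinimal] {p : ℕ} [Fact p.Prime]
  {K : Type} [Field K] [NumberField K]

/-- `d_K` odd is never `-4`. [folklore] -/
private theorem discr_ne_neg_four_of_odd (hodd : Odd (NumberField.discr K)) :
    NumberField.discr K ≠ -4 := by
  intro h4
  rw [h4] at hodd
  exact (Int.not_odd_iff_even.mpr ⟨-2, by norm_num⟩) hodd

/-- **Howard's containment HOLDS on X9 Heegner frames** — the ∃-hypothesis of the Yan–Zhu composite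
`thm57_thm59_bcs422_cgls513_generator_constantCoeff_of_heegnerDivisibility`, DISCHARGED: for an X9 pair
`(E, p)`, `K` imaginary quadratic with `d_K` odd `≠ −3`, the Heegner hypothesis for the parametrisation
level `N = N_E`, `p` split, `p ∤ h_K`, and `(κ, γ)` anticyclotomic with a topological generator, there
ARE data `(jbar, D, F, X)` at level `N` with `(heegnerCharIdeal D F)² ≤ char_Λ(X.X_tors)` — Mastella–Zerman
2026 Cor. 4.6 BY NAME (`h46`) at the hypothesis structure built by file P (`ClassX9.mz26Hypotheses`:
non-CM, (irr), scalars `1 + pℤ_p` in the image — a THEOREM —, `p` odd, `p ∤ N_E`, good ordinary from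
the leaf; `d_K ≠ −4` because `d_K` is odd), at data that exist by §1.
[cite: MastellaZerman2026, Cor. 4.6, Assumptions 2.1 and 2.13] [cite: LombardoTronto2022, Thm. 3.16]
[cite: YanZhu2024MainConjNonCM, Thm. 5.9 (second bullet at S ⊂ Λ^×: the hypothesis discharged here)] -/
theorem ClassX9.exists_heegnerContainment_of_cor46
    (h46 : cor46_howardDivisibility_of_scalarImage.{0}) (h : ClassX9 W p)
    (hK : IsImaginaryQuadratic K) (hodd : Odd (NumberField.discr K)) (h3 : NumberField.discr K ≠ -3)
    {N : ℕ} [NeZero N] (hN : W.conductorNorm ℤ = N) (hHN : SatisfiesHeegnerHypothesis N K)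
    (hHp : SatisfiesHeegnerHypothesis p K) (hh : ¬ p ∣ NumberField.classNumber K)
    (κ : ZpExtension K p) (hκ : κ.IsAnticyclotomic)
    (γ : Field.absoluteGaloisGroup K) [hγ : Fact (κ.IsTopGenerator γ)]
    (Dt : ModularParametrizationData W N) :
    ∃ (jbar : AlgebraicClosure K →+* ℂ) (D : (W.baseChange K).LambdaAdicSelmerData κ γ)
      (F : HeegnerFamily N W K κ jbar) (X : (W.baseChange K).SelmerDualData κ γ),
      heegnerCharIdeal D F ^ 2 ≤
        Module.charIdeal (IwasawaAlgebra p) (Submodule.torsion (IwasawaAlgebra p) X.X) := by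
  subst hN
  obtain ⟨jbar, D, F, X, -⟩ := exists_howardData_of_heegner (W := W) hK hHN h.not_dvd_conductorNorm
    κ hγ.out Dt
  exact heegnerContainment_of_cor46 h46
    (h.mz26Hypotheses κ γ hK ⟨h3, discr_ne_neg_four_of_odd hodd⟩ hHN hHp hh hκ hγ.out) jbar D F X

/-- **The INTEGRAL anticyclotomic main conjecture at `𝟙` on X9 Heegner frames, BY NAME, no image
certificate** (Yan–Zhu 5.7 (1) + 5.9 ∘ BCS 4.2.2 ∘ CGLS 5.1.3 = `h57`, GRANTED Howard's containment,
which `ClassX9.exists_heegnerContainment_of_cor46` supplies from MZ26 Cor. 4.6 = `h46`): for an X9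
pair and the per-frame data of the composite — `K`, (Heeg) for `N = N_E`, (spl), `d_K` odd `≠ −3`,
`p ∤ h_K`, `(ι, v, v̄)`, `(κ, γ)`, a parametrisation datum `Dt` at level `N` and its Heegner point `P`
— `𝒳_{𝓕_Gr}(E/K_∞⁻)` is `Λ`-torsion with a generator `F` and `F(0) = u · c_E⁻² (1 − a_p p⁻¹ + p⁻¹)²
log_{ω_E}(P_K)²`, `u ∈ ℤ_p^×`. Discharged from the leaf: `3 ≤ p`, good ordinary, (irr_K) IN THE KERNEL
(file F `ClassX9.irr_baseChange_of_heegner`). The conclusion is letter for letter that of the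
(sur)-sibling `BurungaleCastellaSkinner2025.thm124b_thm513_generator_constantCoeff`.
[cite: YanZhu2024MainConjNonCM, Thm. 5.7 (1) and Thm. 5.9 (§5.2)] [cite: BurungaleCastellaSkinner2025, Prop. 4.2.2]
[cite: CastellaGrossiLeeSkinner2022, Thm. 5.1.3] [cite: MastellaZerman2026, Cor. 4.6] -/
theorem ClassX9.yz26_generator_constantCoeff_of_cor46
    (h57 : thm57_thm59_bcs422_cgls513_generator_constantCoeff_of_heegnerDivisibility)
    (h46 : cor46_howardDivisibility_of_scalarImage.{0}) (h : ClassX9 W p)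
    (hK : IsImaginaryQuadratic K) (hodd : Odd (NumberField.discr K)) (h3 : NumberField.discr K ≠ -3)
    {N : ℕ} [NeZero N] (hN : W.conductorNorm ℤ = N) (hHN : SatisfiesHeegnerHypothesis N K)
    (hHp : SatisfiesHeegnerHypothesis p K) (hh : ¬ p ∣ NumberField.classNumber K)
    (ι : K →+* ℚ_[p]) (v vbar : HeightOneSpectrum (𝓞 K))
    (hv : ∀ x : 𝓞 K, x ∈ v.asIdeal ↔ ‖ι (x : K)‖ < 1)
    (hvbar : ((p : ℕ) : 𝓞 K) ∈ vbar.asIdeal) (hne : vbar ≠ v)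
    (κ : ZpExtension K p) (hκ : κ.IsAnticyclotomic)
    (γ : Field.absoluteGaloisGroup K) [Fact (κ.IsTopGenerator γ)]
    (Dt : ModularParametrizationData W N)
    (H : HeegnerDatum N (NumberField.discr K)) (ιC : K →+* ℂ) (P : (W.baseChange K).toAffine.Point)
    (hP : WeierstrassCurve.Affine.Point.map ιC.toRatAlgHom P = heegnerPointComplex Dt H) :
    Module.IsTorsion (IwasawaAlgebra p) (AcSelmer.XAc (W.baseChange K) p κ vbar ∅ γ) ∧
      ∃ F : IwasawaAlgebra p,
        AcSelmer.XAc.charIdeal (W.baseChange K) p κ vbar ∅ γ = Ideal.span {F} ∧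
        ∃ u : ℤ_[p]ˣ,
          ((PowerSeries.constantCoeff F : ℤ_[p]) : ℚ_[p]) =
            ((u : ℤ_[p]) : ℚ_[p]) * ((Dt.c : ℚ_[p])⁻¹) ^ 2 *
              (1 - (W.frobeniusTrace p : ℚ_[p]) * (p : ℚ_[p])⁻¹ + (p : ℚ_[p])⁻¹) ^ 2 *
              ((W.baseChange ℚ_[p]).padicLogPoint (formalIndex W p • padicPointOf W p ι P) /
                (formalIndex W p : ℚ_[p])) ^ 2 := by
  have hHN' : SatisfiesHeegnerHypothesis (W.conductorNorm ℤ) K := by rw [hN]; exact hHN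
  exact h57 W p h.three_le h.goodOrd K hK hHN' hHp hodd h3 (h.irr_baseChange_of_heegner hK hHN' hHp)
    hh ι v vbar hv hvbar hne κ hκ γ N Dt H ιC P hP
    (h.exists_heegnerContainment_of_cor46 h46 hK hodd h3 hN hHN hHp hh κ hκ γ Dt)

/-- **The same in the packaged valuation currency** `AcSelmer.XAc.HasCharValuationAt … n ∧ n = 2·(ord_p(1
− a_p + p) − 1 + ord_p log_{ω_E} P_K) − 2·ord_p c_E` on X9 Heegner frames, for every generator with
non-zero constant term (such a generator comes from a control theorem, file R). Bookkeeping over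
`YanZhu2026.hasCharValuationAt_of_heegnerDivisibility`.
[cite: YanZhu2024MainConjNonCM, Thm. 5.7 (1) and Thm. 5.9] [cite: CastellaGrossiLeeSkinner2022, Thm. 5.1.3]
[cite: MastellaZerman2026, Cor. 4.6] -/
theorem ClassX9.hasCharValuationAt_of_yz26_of_cor46
    (h57 : thm57_thm59_bcs422_cgls513_generator_constantCoeff_of_heegnerDivisibility)
    (h46 : cor46_howardDivisibility_of_scalarImage.{0}) (h : ClassX9 W p)
    (hK : IsImaginaryQuadratic K) (hodd : Odd (NumberField.discr K)) (h3 : NumberField.discr K ≠ -3)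
    {N : ℕ} [NeZero N] (hN : W.conductorNorm ℤ = N) (hHN : SatisfiesHeegnerHypothesis N K)
    (hHp : SatisfiesHeegnerHypothesis p K) (hh : ¬ p ∣ NumberField.classNumber K)
    (ι : K →+* ℚ_[p]) (v vbar : HeightOneSpectrum (𝓞 K))
    (hv : ∀ x : 𝓞 K, x ∈ v.asIdeal ↔ ‖ι (x : K)‖ < 1)
    (hvbar : ((p : ℕ) : 𝓞 K) ∈ vbar.asIdeal) (hne : vbar ≠ v)
    (κ : ZpExtension K p) (hκ : κ.IsAnticyclotomic)
    (γ : Field.absoluteGaloisGroup K) [Fact (κ.IsTopGenerator γ)]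
    (Dt : ModularParametrizationData W N)
    (H : HeegnerDatum N (NumberField.discr K)) (ιC : K →+* ℂ) (P : (W.baseChange K).toAffine.Point)
    (hP : WeierstrassCurve.Affine.Point.map ιC.toRatAlgHom P = heegnerPointComplex Dt H)
    (G : IwasawaAlgebra p) (hG : AcSelmer.XAc.charIdeal (W.baseChange K) p κ vbar ∅ γ = Ideal.span {G})
    (hG0 : PowerSeries.constantCoeff G ≠ 0) :
    ∃ n : ℕ, AcSelmer.XAc.HasCharValuationAt (W.baseChange K) p κ vbar ∅ γ n ∧
      (n : ℤ) = 2 * ((padicValInt p (1 - W.frobeniusTrace p + p) : ℤ) - 1 + padicLogOrd W p ι P) -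
        2 * (padicValInt p Dt.c : ℤ) := by
  have hHN' : SatisfiesHeegnerHypothesis (W.conductorNorm ℤ) K := by rw [hN]; exact hHN
  exact hasCharValuationAt_of_heegnerDivisibility h57 h.three_le h.goodOrd K hK hHN' hHp hodd h3
    (h.irr_baseChange_of_heegner hK hHN' hHp) hh ι v vbar hv hvbar hne κ hκ γ Dt H ιC P hP
    (h.exists_heegnerContainment_of_cor46 h46 hK hodd h3 hN hHN hHp hh κ hκ γ Dt) G hG hG0

end X9

/-! ## §3 Class X10b (`p = 3`, `¬ Surj W 3`, non-CM explicit): the same two doors -/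

section X10

variable {W : WeierstrassCurve ℚ} [W.IsElliptic] [W.IsGloballyMinimal] {p : ℕ} [Fact p.Prime]
  {K : Type} [Field K] [NumberField K]

/-- **Howard's containment HOLDS on X10b Heegner frames with `3` split** (non-CM X10b pairs): MZ26 Cor.
4.6 BY NAME at `ClassX10.mz26Hypotheses_of_not_surj` (file P), at data that exist by §1.
[cite: MastellaZerman2026, Cor. 4.6, Assumptions 2.1 and 2.13] [cite: LombardoTronto2022, Prop. 3.12] -/
theorem ClassX10.exists_heegnerContainment_of_cor46_of_not_surj
    (h46 : cor46_howardDivisibility_of_scalarImage.{0}) (h : ClassX10 W p) (hns : ¬ Surj W 3)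
    (hCM : ¬ W.HasCM)
    (hK : IsImaginaryQuadratic K) (hodd : Odd (NumberField.discr K)) (h3 : NumberField.discr K ≠ -3)
    {N : ℕ} [NeZero N] (hN : W.conductorNorm ℤ = N) (hHN : SatisfiesHeegnerHypothesis N K)
    (hHp : SatisfiesHeegnerHypothesis p K) (hh : ¬ p ∣ NumberField.classNumber K)
    (κ : ZpExtension K p) (hκ : κ.IsAnticyclotomic)
    (γ : Field.absoluteGaloisGroup K) [hγ : Fact (κ.IsTopGenerator γ)]
    (Dt : ModularParametrizationData W N) :
    ∃ (jbar : AlgebraicClosure K →+* ℂ) (D : (W.baseChange K).LambdaAdicSelmerData κ γ)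
      (F : HeegnerFamily N W K κ jbar) (X : (W.baseChange K).SelmerDualData κ γ),
      heegnerCharIdeal D F ^ 2 ≤
        Module.charIdeal (IwasawaAlgebra p) (Submodule.torsion (IwasawaAlgebra p) X.X) := by
  subst hN
  obtain ⟨jbar, D, F, X, -⟩ := exists_howardData_of_heegner (W := W) hK hHN h.not_dvd_conductorNorm
    κ hγ.out Dt
  exact heegnerContainment_of_cor46 h46
    (h.mz26Hypotheses_of_not_surj hns hCM κ γ hK ⟨h3, discr_ne_neg_four_of_odd hodd⟩ hHN hHp hh hκ
      hγ.out) jbar D F X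

/-- **The INTEGRAL anticyclotomic main conjecture at `𝟙` on X10b Heegner frames (`p = 3` split), BY
NAME, no image certificate** (`h57` ∘ `h46`; all four printed inputs are stated at `p > 2` / odd `p`;
flag `YZ26@3-BF-ERL-Ohta` travels with `h57`). (irr_K) IN THE KERNEL by file I
`ClassX10.irr_baseChange_of_heegner`. [cite: YanZhu2024MainConjNonCM, Thm. 5.7 (1) and Thm. 5.9 (§5.2, p > 2)]
[cite: BurungaleCastellaSkinner2025, Prop. 4.2.2 (p > 2)] [cite: CastellaGrossiLeeSkinner2022, Thm. 5.1.3 (p > 2)]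
[cite: MastellaZerman2026, Cor. 4.6 (p odd)] -/
theorem ClassX10.yz26_generator_constantCoeff_of_cor46_of_not_surj
    (h57 : thm57_thm59_bcs422_cgls513_generator_constantCoeff_of_heegnerDivisibility)
    (h46 : cor46_howardDivisibility_of_scalarImage.{0}) (h : ClassX10 W p) (hns : ¬ Surj W 3)
    (hCM : ¬ W.HasCM)
    (hK : IsImaginaryQuadratic K) (hodd : Odd (NumberField.discr K)) (h3 : NumberField.discr K ≠ -3)
    {N : ℕ} [NeZero N] (hN : W.conductorNorm ℤ = N) (hHN : SatisfiesHeegnerHypothesis N K)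
    (hHp : SatisfiesHeegnerHypothesis p K) (hh : ¬ p ∣ NumberField.classNumber K)
    (ι : K →+* ℚ_[p]) (v vbar : HeightOneSpectrum (𝓞 K))
    (hv : ∀ x : 𝓞 K, x ∈ v.asIdeal ↔ ‖ι (x : K)‖ < 1)
    (hvbar : ((p : ℕ) : 𝓞 K) ∈ vbar.asIdeal) (hne : vbar ≠ v)
    (κ : ZpExtension K p) (hκ : κ.IsAnticyclotomic)
    (γ : Field.absoluteGaloisGroup K) [Fact (κ.IsTopGenerator γ)]
    (Dt : ModularParametrizationData W N)
    (H : HeegnerDatum N (NumberField.discr K)) (ιC : K →+* ℂ) (P : (W.baseChange K).toAffine.Point)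
    (hP : WeierstrassCurve.Affine.Point.map ιC.toRatAlgHom P = heegnerPointComplex Dt H) :
    Module.IsTorsion (IwasawaAlgebra p) (AcSelmer.XAc (W.baseChange K) p κ vbar ∅ γ) ∧
      ∃ F : IwasawaAlgebra p,
        AcSelmer.XAc.charIdeal (W.baseChange K) p κ vbar ∅ γ = Ideal.span {F} ∧
        ∃ u : ℤ_[p]ˣ,
          ((PowerSeries.constantCoeff F : ℤ_[p]) : ℚ_[p]) =
            ((u : ℤ_[p]) : ℚ_[p]) * ((Dt.c : ℚ_[p])⁻¹) ^ 2 *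
              (1 - (W.frobeniusTrace p : ℚ_[p]) * (p : ℚ_[p])⁻¹ + (p : ℚ_[p])⁻¹) ^ 2 *
              ((W.baseChange ℚ_[p]).padicLogPoint (formalIndex W p • padicPointOf W p ι P) /
                (formalIndex W p : ℚ_[p])) ^ 2 := by
  have hHN' : SatisfiesHeegnerHypothesis (W.conductorNorm ℤ) K := by rw [hN]; exact hHN
  exact h57 W p h.three_le h.goodOrd K hK hHN' hHp hodd h3 (h.irr_baseChange_of_heegner hK hHN' hHp)
    hh ι v vbar hv hvbar hne κ hκ γ N Dt H ιC P hP
    (h.exists_heegnerContainment_of_cor46_of_not_surj h46 hns hCM hK hodd h3 hN hHN hHp hh κ hκ γ Dt)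

/-- **The packaged valuation currency on X10b Heegner frames** (`p = 3` split, non-CM), for every
generator with non-zero constant term. [cite: YanZhu2024MainConjNonCM, Thm. 5.7 (1) and Thm. 5.9]
[cite: CastellaGrossiLeeSkinner2022, Thm. 5.1.3] [cite: MastellaZerman2026, Cor. 4.6] -/
theorem ClassX10.hasCharValuationAt_of_yz26_of_cor46_of_not_surj
    (h57 : thm57_thm59_bcs422_cgls513_generator_constantCoeff_of_heegnerDivisibility)
    (h46 : cor46_howardDivisibility_of_scalarImage.{0}) (h : ClassX10 W p) (hns : ¬ Surj W 3)
    (hCM : ¬ W.HasCM)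
    (hK : IsImaginaryQuadratic K) (hodd : Odd (NumberField.discr K)) (h3 : NumberField.discr K ≠ -3)
    {N : ℕ} [NeZero N] (hN : W.conductorNorm ℤ = N) (hHN : SatisfiesHeegnerHypothesis N K)
    (hHp : SatisfiesHeegnerHypothesis p K) (hh : ¬ p ∣ NumberField.classNumber K)
    (ι : K →+* ℚ_[p]) (v vbar : HeightOneSpectrum (𝓞 K))
    (hv : ∀ x : 𝓞 K, x ∈ v.asIdeal ↔ ‖ι (x : K)‖ < 1)
    (hvbar : ((p : ℕ) : 𝓞 K) ∈ vbar.asIdeal) (hne : vbar ≠ v)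
    (κ : ZpExtension K p) (hκ : κ.IsAnticyclotomic)
    (γ : Field.absoluteGaloisGroup K) [Fact (κ.IsTopGenerator γ)]
    (Dt : ModularParametrizationData W N)
    (H : HeegnerDatum N (NumberField.discr K)) (ιC : K →+* ℂ) (P : (W.baseChange K).toAffine.Point)
    (hP : WeierstrassCurve.Affine.Point.map ιC.toRatAlgHom P = heegnerPointComplex Dt H)
    (G : IwasawaAlgebra p) (hG : AcSelmer.XAc.charIdeal (W.baseChange K) p κ vbar ∅ γ = Ideal.span {G})
    (hG0 : PowerSeries.constantCoeff G ≠ 0) :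
    ∃ n : ℕ, AcSelmer.XAc.HasCharValuationAt (W.baseChange K) p κ vbar ∅ γ n ∧
      (n : ℤ) = 2 * ((padicValInt p (1 - W.frobeniusTrace p + p) : ℤ) - 1 + padicLogOrd W p ι P) -
        2 * (padicValInt p Dt.c : ℤ) := by
  have hHN' : SatisfiesHeegnerHypothesis (W.conductorNorm ℤ) K := by rw [hN]; exact hHN
  exact hasCharValuationAt_of_heegnerDivisibility h57 h.three_le h.goodOrd K hK hHN' hHp hodd h3
    (h.irr_baseChange_of_heegner hK hHN' hHp) hh ι v vbar hv hvbar hne κ hκ γ Dt H ιC P hP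
    (h.exists_heegnerContainment_of_cor46_of_not_surj h46 hns hCM hK hodd h3 hN hHN hHp hh κ hκ γ Dt)
    G hG hG0

end X10

end Literature.NumberTheory.EllipticCurves.Rank1Residual

end
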